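import Literature.MathematicalPhysics.QuantumFieldTheory.Balaban1983to89.B10Eq18ChangeOfVariables
import Summits.QuantumFields.YangMills.Theorems.BalabanUVNodesN11KernelTransportInFibreChart
import Summits.QuantumFields.YangMills.Theorems.BalabanUVNodesN11DeltaRemovalLinearFibreChart

/-!
# DAG node N11 — steps S2∘S3 of ME #37 composed: THE SMALL-FIELD FIBRE CHART OF THE AVERAGING IN THE CHART
# («the change of variables A′ = A − D̃(A) … Q(A − D̃(A,c), c) = (QA)(c)», [16] (17)–(18) p.260; «B′ = B − hD(B) … LQ̃B′ + C̃(B′) = LQ̃B»,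
# [I] p.267; then «we remove the δ-functions using the operator C», [I] p.268 ∕ [III] p.267) — `hpush` ∕ `hfib` of dag-n11-d's socket for
# the NONLINEAR chart averaging `𝒬`, Jacobian `1_S · |det(I − (δ∕δA)D̃)| · |det Q_{b₀}|⁻¹`, and the socket consumed BY NAME

HEADER — WORK-UNIT METADATA.  Cell `pub-ymgap`, YM-PLAN Track A (HUMAN RULING D-0062), WIDTH SEAT `pub-ymgap-dag-n11-w6` (R399 (3a) re-mint, g0b), node N11
[B14], route `BalabanUVNodes`, item K1⁷ `StabilityBAtRecordR13SepCoPH` = stmt-QuantumFields-20542 (helper lane, `--kind proof --supports 20542 --as helper`,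
count-neutral).  [I] = [Balaban1987RG1] (CMP 109), [III] = [Balaban1988Convergent] (CMP 119), [13] = [Balaban1985BackgroundPropagators] (CMP 99), [16] =
[Balaban1985UV3] (CMP 102).  Over: part 1 of this seat `BalabanUVNodesN11DeltaRemovalLinearFibreChart` (S3: the linear chart `Φ (y, B) = C B + H y`,
`measurePreserving_chart`, `linearAvg_chart`, `lintegral∕integral_eq_integral_chart`); r07's `Literature/…/B10Eq18ChangeOfVariables` (S2, [16] (18) AS A THEOREM:
`hasFDerivWithinAt_id_sub`, `lintegral∕integral_image_id_sub`, `integrableOn_image_id_sub_iff` — cited BY NAME, nothing restated); Mathlib's Jacobian file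
(`map_withDensity_abs_det_fderiv_eq_addHaar`); dag-n11-d's socket `BalabanUVNodesN11KernelTransportInFibreChart` (★★ `map_withDensity_eq_withDensity_lintegral_chart`,
★ `lintegral_comp_avg_mul_eq_chart`).

WHY THIS FILE.  In Lie-algebra coordinates the averaging of [16] (15) is NONLINEAR, `𝒬(A′) = QA′ + C̃(A′)`; print straightens its fibres with the substitution
`A′ = A − D̃(A)` ((17): `𝒬(A − D̃(A)) = QA` «for A sufficiently small», i.e. on a small-field region `S`) and then eliminates the LINEAR constraint `δ(QA)` with
the operator `C` (S3, part 1).  Composing: the map `Ψ (y, B) = (id − D̃)(CB + Hy)` charts the fibre `{A′ : 𝒬(A′) = y}` inside the image region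
`(id − D̃)'' S`, and Lebesgue measure `dA′` restricted to that region is the push-forward of `dy ⊗ dB` with the density
`J (y, B) = 1_S(CB + Hy) · |det(I − (δ∕δA)D̃ (CB + Hy))| · |det Q_{b₀}|⁻¹` — print's integrand of (18) ∕ (51) ∕ [I] (2.12) «∫dA det(I − (δ∕δA)D̃(A)) … δ(QA) … χ …»
read as a fibre chart.  This is EXACTLY the pair `hpush` ∕ `hfib` dag-n11-d's socket asks of a chart seat, for the averaging `𝒬` and the charted set
`(id − D̃)'' S` — and `hfib` holds precisely where `J ≠ 0`, as the socket is designed.  What stays OUT: the Lie–Haar factor S1 («dU′ = σ(A′)dA′», [16]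
p.260) and the identification of `𝒬` with the group-valued averaging at `fieldMeasure` through the exponential ∕ axial chart — the concrete chart half, the
director's lever.

WHAT THIS FILE PROVES (0 `def`, 0 `sorry`, standard axioms; hypothesis-form: part 1's letters `e, Q, H, C` with `hQH : ∀ y, Q (H y) = y`,
`hH : ∀ y s, H y (e (inl s)) = 0`, `hC : ∀ B s, C B (e (inl s)) = B s`, `hQC : ∀ B, Q (C B) = 0`; the chart averaging `𝒬 : (ι → X) → (κ → X)`, print's `D̃` as
`𝒟 : (ι → X) → (ι → X)` with derivative `L` on the region `S`: `hS : MeasurableSet S`, `h𝒟 : ∀ A ∈ S, HasFDerivWithinAt 𝒟 (L A) S A`, `hinj : InjOn (id − 𝒟) S`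
(r07's `injOn_id_sub_of_nnnorm_fderiv_le` supplies it from `‖L‖ ≤ K < 1` on a convex `S`), `hlin : ∀ A ∈ S, 𝒬 (A − 𝒟 A) = Q A` ((17)); for the socket-literal
forms the socket's own measurability demands `Measurable 𝒟`, `Measurable 𝒬`, `Measurable (A ↦ |det(I − L A)|)`).
§0 `map_withDensity_comp_eq` (plumbing: `map Φ (μ.withDensity (f ∘ Φ)) = (map Φ μ).withDensity f`).
§1 ★★ `lintegral_image_linearisation_eq_chart` (`∫⁻_{(id−D̃)''S} g = |det Q_{b₀}|⁻¹ · ∫⁻ dy ∫⁻ dB 1_S·|det(I − ∂D̃)|·g∘(id − D̃) (CB + Hy)`) ·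
   `integrableOn_image_linearisation_iff` · ★★ `integral_image_linearisation_eq_chart` (Bochner form, for `F` integrable on the image region).
§2 ★★★ `hpush_linearised` · ★ `hfib_linearised` (the socket's displayed hypotheses for `(𝒬, Ψ, J)`, fibre reference `Kernel.const _ volume`).
§3 ★★★ `map_withDensity_chartAvg_eq` (socket ★★ BY NAME: `(g·dA′).map 𝒬 = (y ↦ |det Q_{b₀}|⁻¹ ∫⁻ dB 1_S·|det(I − ∂D̃)|·g((id − D̃)(CB + Hy))) · dy` for `g`
   vanishing off the image region) · ★★ `lintegral_comp_chartAvg_mul_eq` ∕ ★★ `integral_comp_chartAvg_mul_eq` (socket ★ BY NAME: the tested Tonelli ∕ Bochner forms).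

HONEST FRAMING.  Helper lane of K1⁷; count-neutral; Lebesgue change of variables (Mathlib) + Fubini + two socket theorems applied by name; NO Lie–Haar chart
(S1), nothing at `fieldMeasure`, no estimate, no identification of `𝒬 ∕ 𝒟` with Bałaban's concrete (14)–(17) objects (that is [16] Sect. A ∕ `B10Eq17LocalSolution`
∕ `Node00` business); nothing of Bałaban asserted beyond bookkeeping shape; (B4)∕(S-α) NOT closed; N11 NOT discharged; K1⁷ NOT closed; node counts unmoved.
R4 closes only the conditional finite-𝕋⁴ rung `BalabanLadder.UV` — NOT ℝ⁴, NOT OS, NOT a mass gap, NOT Clay.  No `sorry`, `axiom`, `def`, `instance`,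
`notation`.  Sources (SHAPE ∕ bookkeeping only): [16] (13) p.259, (17)–(18) p.260, (50)–(51) p.268; [I] (1.4) p.260, p.267 L.16–32, p.268 L.1–5, (2.12) p.268;
[III] (2.21) p.258, p.267 L.18–24; [13] Sect. E p.428.
-/

noncomputable section

open MeasureTheory ProbabilityTheory Set
open scoped ENNReal NNReal

namespace Summit.QuantumFields.YangMills.Theorems.BalabanUVNodesN11DeltaRemovalLinearisedChart

open Literature.MathematicalPhysics.QuantumFieldTheory.Balaban1983to89
open Summit.QuantumFields.YangMills.Theorems.BalabanUVNodesN11DeltaRemovalLinearFibreChart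

/-! ## §0  Plumbing: a density pulled back along a measurable map -/

/-- Pushing forward a measure carrying a pulled-back density: `map Φ (μ.withDensity (f ∘ Φ)) = (map Φ μ).withDensity f` (Φ, f measurable). [folklore] -/
theorem map_withDensity_comp_eq {α β : Type*} [MeasurableSpace α] [MeasurableSpace β] (μ : Measure α)
    {Φ : α → β} (hΦ : Measurable Φ) {f : β → ℝ≥0∞} (hf : Measurable f) :
    Measure.map Φ (μ.withDensity (f ∘ Φ)) = (Measure.map Φ μ).withDensity f := by
  ext s hs
  rw [Measure.map_apply hΦ hs, withDensity_apply _ (hΦ hs), withDensity_apply _ hs, setLIntegral_map hs hf hΦ]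
  rfl

section Chart

variable {X : Type*} [NormedAddCommGroup X] [NormedSpace ℝ X] [FiniteDimensional ℝ X] [MeasureSpace X] [BorelSpace X]
  [(volume : Measure X).IsAddHaarMeasure]
variable {ι κ σ : Type*} [Fintype ι] [Fintype κ] [Fintype σ] {e : σ ⊕ κ ≃ ι}
variable {Q : (ι → X) →ₗ[ℝ] (κ → X)} {H : (κ → X) →ₗ[ℝ] (ι → X)} {C : (σ → X) →ₗ[ℝ] (ι → X)}
variable {𝒬 : (ι → X) → (κ → X)} {𝒟 : (ι → X) → (ι → X)} {L : (ι → X) → ((ι → X) →L[ℝ] (ι → X))} {S : Set (ι → X)}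

/-! ## §1  The integral identities of S2∘S3: `∫_{(id−D̃)''S} dA′ F(A′) = |det Q_{b₀}|⁻¹ ∫ dy ∫ dB 1_S·|det(I − ∂D̃)|·F∘(id − D̃) (CB + Hy)` -/

/-- **★★ TONELLI FORM OF S2∘S3**: for every measurable `g ≥ 0` of the variables `A′`,
`∫⁻_{A′ ∈ (id − D̃)''S} g(A′) dA′ = |det (H↾corridor)| · ∫⁻ dy ∫⁻ dB (1_S · |det(I − (δ∕δA)D̃)| · g∘(id − D̃)) (CB + Hy)` — the substitution (18) (r07's
`lintegral_image_id_sub`) followed by the δ-removal (part 1's `lintegral_eq_lintegral_chart`); `|det (H↾corridor)| = |det Q_{b₀}|⁻¹`.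
[cite: Balaban1985UV3, (17)-(18) p.260, (50)-(51) p.268; Balaban1987RG1, p.267 L.25–32, p.268 L.1–5] -/
theorem lintegral_image_linearisation_eq_chart (hQH : ∀ y, Q (H y) = y) (hH : ∀ y s, H y (e (Sum.inl s)) = 0)
    (hC : ∀ B s, C B (e (Sum.inl s)) = B s) (hS : MeasurableSet S) (h𝒟 : ∀ A ∈ S, HasFDerivWithinAt 𝒟 (L A) S A)
    (hinj : InjOn (fun A => A - 𝒟 A) S) (h𝒟m : Measurable 𝒟)
    (hLm : Measurable fun A => |((1 : (ι → X) →L[ℝ] (ι → X)) - L A).det|) {g : (ι → X) → ℝ≥0∞} (hg : Measurable g) :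
    ∫⁻ A' in (fun A => A - 𝒟 A) '' S, g A' =
      ENNReal.ofReal |LinearMap.det ((LinearMap.funLeft ℝ X (fun c => e (Sum.inr c))) ∘ₗ H)| *
        ∫⁻ y, ∫⁻ B, S.indicator (fun A => ENNReal.ofReal |((1 : (ι → X) →L[ℝ] (ι → X)) - L A).det| * g (A - 𝒟 A))
          (C B + H y) := by
  have hmeas : Measurable
      (S.indicator fun A => ENNReal.ofReal |((1 : (ι → X) →L[ℝ] (ι → X)) - L A).det| * g (A - 𝒟 A)) :=
    (hLm.ennreal_ofReal.mul (hg.comp (measurable_id.sub h𝒟m))).indicator hS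
  rw [B10Eq18ChangeOfVariables.lintegral_image_id_sub volume hS h𝒟 hinj g, ← lintegral_indicator hS,
    lintegral_eq_lintegral_chart hQH hH hC hmeas]

omit [(volume : Measure X).IsAddHaarMeasure] in
/-- Integrability transfers along S2∘S3: `F` is integrable on the image region `(id − D̃)''S` iff `1_S · |det(I − ∂D̃)| · F∘(id − D̃)` is integrable
(r07's `integrableOn_image_id_sub_iff`). [cite: Balaban1985UV3, (13) p.259, (18) p.260] -/
theorem integrableOn_image_linearisation_iff [(volume : Measure X).IsAddHaarMeasure] (hS : MeasurableSet S)
    (h𝒟 : ∀ A ∈ S, HasFDerivWithinAt 𝒟 (L A) S A) (hinj : InjOn (fun A => A - 𝒟 A) S)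
    {E' : Type*} [NormedAddCommGroup E'] [NormedSpace ℝ E'] (F : (ι → X) → E') :
    IntegrableOn F ((fun A => A - 𝒟 A) '' S) ↔
      Integrable (S.indicator fun A => |((1 : (ι → X) →L[ℝ] (ι → X)) - L A).det| • F (A - 𝒟 A)) := by
  rw [integrable_indicator_iff hS]
  exact B10Eq18ChangeOfVariables.integrableOn_image_id_sub_iff volume hS h𝒟 hinj F

/-- **★★ BOCHNER FORM OF S2∘S3**: for every `F` integrable on the image region,
`∫_{A′ ∈ (id − D̃)''S} F(A′) dA′ = |det (H↾corridor)| · ∫ dy ∫ dB (1_S · |det(I − (δ∕δA)D̃)| · F∘(id − D̃)) (CB + Hy)` — the printed integrand of (18)∕(51)∕(2.12)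
«∫dA det(I − (δ∕δA)D̃(A)) … δ(QA) …» after the δ-removal. [cite: Balaban1985UV3, (17)-(18) p.260, (50)-(51) p.268; Balaban1987RG1, (2.12) p.268] -/
theorem integral_image_linearisation_eq_chart (hQH : ∀ y, Q (H y) = y) (hH : ∀ y s, H y (e (Sum.inl s)) = 0)
    (hC : ∀ B s, C B (e (Sum.inl s)) = B s) (hS : MeasurableSet S) (h𝒟 : ∀ A ∈ S, HasFDerivWithinAt 𝒟 (L A) S A)
    (hinj : InjOn (fun A => A - 𝒟 A) S)
    {E' : Type*} [NormedAddCommGroup E'] [NormedSpace ℝ E'] {F : (ι → X) → E'} (hF : IntegrableOn F ((fun A => A - 𝒟 A) '' S)) :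
    ∫ A' in (fun A => A - 𝒟 A) '' S, F A' =
      |LinearMap.det ((LinearMap.funLeft ℝ X (fun c => e (Sum.inr c))) ∘ₗ H)| •
        ∫ y, ∫ B, S.indicator (fun A => |((1 : (ι → X) →L[ℝ] (ι → X)) - L A).det| • F (A - 𝒟 A)) (C B + H y) := by
  rw [B10Eq18ChangeOfVariables.integral_image_id_sub volume hS h𝒟 hinj F, ← integral_indicator hS]
  exact integral_eq_integral_chart hQH hH hC ((integrableOn_image_linearisation_iff hS h𝒟 hinj F).mp hF)

/-! ## §2  The socket's displayed hypotheses for the chart averaging `𝒬`: `Ψ (y, B) = (id − D̃)(CB + Hy)`, `J = 1_S·|det(I − ∂D̃)|·|det Q_{b₀}|⁻¹` -/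

/-- **★★★ `hpush` FOR THE AVERAGING IN THE CHART**: `((dy ⊗ dB) · J).map Ψ = dA′↾(id − D̃)''S` with `Ψ (y, B) = (id − D̃)(CB + Hy)` and
`J (y, B) = 1_S(CB + Hy) · |det Q_{b₀}|⁻¹ · |det(I − (δ∕δA)D̃ (CB + Hy))|` — part 1's `measurePreserving_chart` composed with Mathlib's
`map_withDensity_abs_det_fderiv_eq_addHaar` through r07's `hasFDerivWithinAt_id_sub`. [cite: Balaban1985UV3, (17)-(18) p.260, (50)-(51) p.268; Balaban1987RG1, p.267 L.25–32, p.268 L.1–5; Balaban1988Convergent, p.267 L.18–24] -/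
theorem hpush_linearised (hQH : ∀ y, Q (H y) = y) (hH : ∀ y s, H y (e (Sum.inl s)) = 0)
    (hC : ∀ B s, C B (e (Sum.inl s)) = B s) (hS : MeasurableSet S) (h𝒟 : ∀ A ∈ S, HasFDerivWithinAt 𝒟 (L A) S A)
    (hinj : InjOn (fun A => A - 𝒟 A) S) (h𝒟m : Measurable 𝒟)
    (hLm : Measurable fun A => |((1 : (ι → X) →L[ℝ] (ι → X)) - L A).det|) :
    (((volume : Measure (κ → X)) ⊗ₘ (Kernel.const (κ → X) (volume : Measure (σ → X)))).withDensity
        (fun z => ((S.indicator (fun A =>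
          Real.toNNReal |LinearMap.det ((LinearMap.funLeft ℝ X (fun c => e (Sum.inr c))) ∘ₗ H)| *
            Real.toNNReal |((1 : (ι → X) →L[ℝ] (ι → X)) - L A).det|) (C z.2 + H z.1) : ℝ≥0) : ℝ≥0∞))).map
      (fun z : (κ → X) × (σ → X) => (C z.2 + H z.1) - 𝒟 (C z.2 + H z.1)) =
    (volume : Measure (ι → X)).restrict ((fun A => A - 𝒟 A) '' S) := by
  have hρm : Measurable fun A : ι → X => ENNReal.ofReal |((1 : (ι → X) →L[ℝ] (ι → X)) - L A).det| := hLm.ennreal_ofReal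
  have hΦm : Measurable (fun z : (κ → X) × (σ → X) => C z.2 + H z.1) := measurable_chart
  have hTm : Measurable (fun A : ι → X => A - 𝒟 A) := measurable_id.sub h𝒟m
  -- (1) the density as (constant) · (pulled-back indicator density)
  have hdens : (fun z : (κ → X) × (σ → X) => ((S.indicator (fun A =>
          Real.toNNReal |LinearMap.det ((LinearMap.funLeft ℝ X (fun c => e (Sum.inr c))) ∘ₗ H)| *
            Real.toNNReal |((1 : (ι → X) →L[ℝ] (ι → X)) - L A).det|) (C z.2 + H z.1) : ℝ≥0) : ℝ≥0∞)) =
      (fun _ => ENNReal.ofReal |LinearMap.det ((LinearMap.funLeft ℝ X (fun c => e (Sum.inr c))) ∘ₗ H)|) *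
        ((S.indicator fun A : ι → X => ENNReal.ofReal |((1 : (ι → X) →L[ℝ] (ι → X)) - L A).det|) ∘
          (fun z : (κ → X) × (σ → X) => C z.2 + H z.1)) := by
    funext z
    simp only [Pi.mul_apply, Function.comp_apply]
    by_cases hz : C z.2 + H z.1 ∈ S
    · rw [indicator_of_mem hz, indicator_of_mem hz, ENNReal.coe_mul]
      rfl
    · rw [indicator_of_notMem hz, indicator_of_notMem hz, ENNReal.coe_zero, mul_zero]
  have hΨ : (fun z : (κ → X) × (σ → X) => (C z.2 + H z.1) - 𝒟 (C z.2 + H z.1)) =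
      (fun A => A - 𝒟 A) ∘ (fun z : (κ → X) × (σ → X) => C z.2 + H z.1) := rfl
  rw [Measure.compProd_const, hdens, withDensity_mul _ measurable_const ((hρm.indicator hS).comp hΦm), withDensity_const,
    hΨ, ← Measure.map_map hTm hΦm, map_withDensity_comp_eq _ hΦm (hρm.indicator hS),
    (measurePreserving_chart hQH hH hC).map_eq, withDensity_indicator hS]
  exact map_withDensity_abs_det_fderiv_eq_addHaar volume hS.nullMeasurableSet
    (fun A hA => B10Eq18ChangeOfVariables.hasFDerivWithinAt_id_sub h𝒟 hA) hinj

omit [(volume : Measure X).IsAddHaarMeasure] in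
/-- **★ `hfib` FOR THE AVERAGING IN THE CHART**: almost everywhere for the measure `(any measure) · J` — i.e. wherever `J ≠ 0`, so wherever the chart point
`CB + Hy` lies in the small-field region `S` — `𝒬 ((id − D̃)(CB + Hy)) = Q (CB + Hy) = y` ((17) + part 1's exact fibre identity).
[cite: Balaban1985UV3, (17) p.260; Balaban1987RG1, p.267 L.25–32] -/
theorem hfib_linearised (hQH : ∀ y, Q (H y) = y) (hQC : ∀ B, Q (C B) = 0) (hS : MeasurableSet S)
    (hlin : ∀ A ∈ S, 𝒬 (A - 𝒟 A) = Q A)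
    (hLm : Measurable fun A => |((1 : (ι → X) →L[ℝ] (ι → X)) - L A).det|) (m : Measure ((κ → X) × (σ → X))) :
    ∀ᵐ z ∂(m.withDensity (fun z => ((S.indicator (fun A =>
          Real.toNNReal |LinearMap.det ((LinearMap.funLeft ℝ X (fun c => e (Sum.inr c))) ∘ₗ H)| *
            Real.toNNReal |((1 : (ι → X) →L[ℝ] (ι → X)) - L A).det|) (C z.2 + H z.1) : ℝ≥0) : ℝ≥0∞))),
      𝒬 ((fun z : (κ → X) × (σ → X) => (C z.2 + H z.1) - 𝒟 (C z.2 + H z.1)) z) = z.1 := by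
  have hJm : Measurable (fun z : (κ → X) × (σ → X) => ((S.indicator (fun A =>
          Real.toNNReal |LinearMap.det ((LinearMap.funLeft ℝ X (fun c => e (Sum.inr c))) ∘ₗ H)| *
            Real.toNNReal |((1 : (ι → X) →L[ℝ] (ι → X)) - L A).det|) (C z.2 + H z.1) : ℝ≥0) : ℝ≥0∞)) :=
    (((measurable_const.mul hLm.real_toNNReal).indicator hS).comp measurable_chart).coe_nnreal_ennreal
  refine (ae_withDensity_iff hJm).mpr (Filter.Eventually.of_forall fun z hz => ?_)
  have hzS : C z.2 + H z.1 ∈ S := by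
    by_contra hnot
    exact hz (by rw [indicator_of_notMem hnot, ENNReal.coe_zero])
  dsimp only
  rw [hlin _ hzS, linearAvg_chart hQH hQC]

/-! ## §3  BY NAME through dag-n11-d's socket: the push-forward of `g·dA′` along the chart averaging `𝒬` -/

/-- **★★★ «∫dA′ δ(𝒬(A′) − y) g(A′)» AS A DENSITY** — the socket's ★★ `map_withDensity_eq_withDensity_lintegral_chart` fed with `hpush_linearised` ∕
`hfib_linearised`: for every measurable `g ≥ 0` of the variables `A′` vanishing off the image region `(id − D̃)''S`,
`(g·dA′).map 𝒬 = (y ↦ |det Q_{b₀}|⁻¹ ∫⁻ dB (1_S · |det(I − (δ∕δA)D̃)| · g∘(id − D̃)) (CB + Hy)) · dy` — print's integrand «∫dA det(I − δD̃∕δA) … δ(QA) …» of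
(18)∕(51)∕(2.12), at `y = 0`. [cite: Balaban1985UV3, (17)-(18) p.260, (50)-(51) p.268; Balaban1987RG1, (1.4) p.260, (2.12) p.268; Balaban1988Convergent, p.267 L.18–24] -/
theorem map_withDensity_chartAvg_eq (hQH : ∀ y, Q (H y) = y) (hH : ∀ y s, H y (e (Sum.inl s)) = 0)
    (hC : ∀ B s, C B (e (Sum.inl s)) = B s) (hQC : ∀ B, Q (C B) = 0) (hS : MeasurableSet S)
    (h𝒟 : ∀ A ∈ S, HasFDerivWithinAt 𝒟 (L A) S A) (hinj : InjOn (fun A => A - 𝒟 A) S)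
    (hlin : ∀ A ∈ S, 𝒬 (A - 𝒟 A) = Q A) (h𝒟m : Measurable 𝒟) (h𝒬m : Measurable 𝒬)
    (hLm : Measurable fun A => |((1 : (ι → X) →L[ℝ] (ι → X)) - L A).det|)
    {g : (ι → X) → ℝ≥0∞} (hg : Measurable g) (hgS : ∀ A', A' ∉ (fun A => A - 𝒟 A) '' S → g A' = 0) :
    ((volume : Measure (ι → X)).withDensity g).map 𝒬 =
      (volume : Measure (κ → X)).withDensity (fun y =>
        ENNReal.ofReal |LinearMap.det ((LinearMap.funLeft ℝ X (fun c => e (Sum.inr c))) ∘ₗ H)| *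
          ∫⁻ B, S.indicator (fun A => ENNReal.ofReal |((1 : (ι → X) →L[ℝ] (ι → X)) - L A).det| * g (A - 𝒟 A))
            (C B + H y)) := by
  have h := BalabanUVNodesN11KernelTransportInFibreChart.map_withDensity_eq_withDensity_lintegral_chart
    (ν := (volume : Measure (ι → X))) (μ := (volume : Measure (κ → X)))
    (κ := Kernel.const (κ → X) (volume : Measure (σ → X))) (avg := 𝒬)
    (Ψ := fun z : (κ → X) × (σ → X) => (C z.2 + H z.1) - 𝒟 (C z.2 + H z.1))
    (J := fun z : (κ → X) × (σ → X) => S.indicator (fun A =>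
      Real.toNNReal |LinearMap.det ((LinearMap.funLeft ℝ X (fun c => e (Sum.inr c))) ∘ₗ H)| *
        Real.toNNReal |((1 : (ι → X) →L[ℝ] (ι → X)) - L A).det|) (C z.2 + H z.1))
    (S := (fun A => A - 𝒟 A) '' S)
    h𝒬m (measurable_chart.sub (h𝒟m.comp measurable_chart))
    (((measurable_const.mul hLm.real_toNNReal).indicator hS).comp measurable_chart)
    (hpush_linearised hQH hH hC hS h𝒟 hinj h𝒟m hLm) (hfib_linearised hQH hQC hS hlin hLm _) hg hgS
  rw [h]
  refine congrArg _ (funext fun y => ?_)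
  have hmeas : Measurable fun B : σ → X =>
      S.indicator (fun A => ENNReal.ofReal |((1 : (ι → X) →L[ℝ] (ι → X)) - L A).det| * g (A - 𝒟 A)) (C B + H y) :=
    ((hLm.ennreal_ofReal.mul (hg.comp (measurable_id.sub h𝒟m))).indicator hS).comp
      (C.continuous_of_finiteDimensional.add continuous_const).measurable
  dsimp only
  rw [Kernel.const_apply, ← lintegral_const_mul _ hmeas]
  refine lintegral_congr fun B => ?_
  by_cases hB : C B + H y ∈ S
  · rw [indicator_of_mem hB, indicator_of_mem hB, ENNReal.coe_mul, mul_assoc]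
    rfl
  · rw [indicator_of_notMem hB, indicator_of_notMem hB, ENNReal.coe_zero, zero_mul, mul_zero]

/-- **★★ THE TESTED TONELLI FORM** (socket ★ `lintegral_comp_avg_mul_eq_chart` by name): for measurable `φ ≥ 0` of the block variables and `g ≥ 0` of the
variables `A′` vanishing off the image region, `∫⁻ dA′ φ(𝒬A′) g(A′) = ∫⁻ dy φ(y) · |det Q_{b₀}|⁻¹ ∫⁻ dB (1_S·|det(I − ∂D̃)|·g∘(id − D̃)) (CB + Hy)` — print's
insertion of the constrained integral under the next `dy`-integration. [cite: Balaban1985UV3, (18) p.260, (51) p.268; Balaban1987RG1, (1.4) p.260, (2.12) p.268; Balaban1988Convergent, (2.21) p.258] -/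
theorem lintegral_comp_chartAvg_mul_eq (hQH : ∀ y, Q (H y) = y) (hH : ∀ y s, H y (e (Sum.inl s)) = 0)
    (hC : ∀ B s, C B (e (Sum.inl s)) = B s) (hQC : ∀ B, Q (C B) = 0) (hS : MeasurableSet S)
    (h𝒟 : ∀ A ∈ S, HasFDerivWithinAt 𝒟 (L A) S A) (hinj : InjOn (fun A => A - 𝒟 A) S)
    (hlin : ∀ A ∈ S, 𝒬 (A - 𝒟 A) = Q A) (h𝒟m : Measurable 𝒟) (h𝒬m : Measurable 𝒬)
    (hLm : Measurable fun A => |((1 : (ι → X) →L[ℝ] (ι → X)) - L A).det|)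
    {φ : (κ → X) → ℝ≥0∞} (hφ : Measurable φ)
    {g : (ι → X) → ℝ≥0∞} (hg : Measurable g) (hgS : ∀ A', A' ∉ (fun A => A - 𝒟 A) '' S → g A' = 0) :
    ∫⁻ A', φ (𝒬 A') * g A' = ∫⁻ y, φ y *
      (ENNReal.ofReal |LinearMap.det ((LinearMap.funLeft ℝ X (fun c => e (Sum.inr c))) ∘ₗ H)| *
        ∫⁻ B, S.indicator (fun A => ENNReal.ofReal |((1 : (ι → X) →L[ℝ] (ι → X)) - L A).det| * g (A - 𝒟 A))
          (C B + H y)) := by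
  have h := BalabanUVNodesN11KernelTransportInFibreChart.lintegral_comp_avg_mul_eq_chart
    (ν := (volume : Measure (ι → X))) (μ := (volume : Measure (κ → X)))
    (κ := Kernel.const (κ → X) (volume : Measure (σ → X))) (avg := 𝒬)
    (Ψ := fun z : (κ → X) × (σ → X) => (C z.2 + H z.1) - 𝒟 (C z.2 + H z.1))
    (J := fun z : (κ → X) × (σ → X) => S.indicator (fun A =>
      Real.toNNReal |LinearMap.det ((LinearMap.funLeft ℝ X (fun c => e (Sum.inr c))) ∘ₗ H)| *
        Real.toNNReal |((1 : (ι → X) →L[ℝ] (ι → X)) - L A).det|) (C z.2 + H z.1))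
    (S := (fun A => A - 𝒟 A) '' S)
    h𝒬m (measurable_chart.sub (h𝒟m.comp measurable_chart))
    (((measurable_const.mul hLm.real_toNNReal).indicator hS).comp measurable_chart)
    (hpush_linearised hQH hH hC hS h𝒟 hinj h𝒟m hLm) (hfib_linearised hQH hQC hS hlin hLm _) hφ hg hgS
  rw [h]
  refine lintegral_congr fun y => ?_
  have hmeas : Measurable fun B : σ → X =>
      S.indicator (fun A => ENNReal.ofReal |((1 : (ι → X) →L[ℝ] (ι → X)) - L A).det| * g (A - 𝒟 A)) (C B + H y) :=
    ((hLm.ennreal_ofReal.mul (hg.comp (measurable_id.sub h𝒟m))).indicator hS).comp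
      (C.continuous_of_finiteDimensional.add continuous_const).measurable
  dsimp only
  rw [Kernel.const_apply, ← lintegral_const_mul _ hmeas]
  congr 1
  refine lintegral_congr fun B => ?_
  by_cases hB : C B + H y ∈ S
  · rw [indicator_of_mem hB, indicator_of_mem hB, ENNReal.coe_mul, mul_assoc]
    rfl
  · rw [indicator_of_notMem hB, indicator_of_notMem hB, ENNReal.coe_zero, zero_mul, mul_zero]

/-- **★★ THE TESTED BOCHNER FORM** (socket ★ `integral_comp_avg_mul_eq_chart` by name): for a measurable integrable real `ρ` of the variables `A′` vanishing off
the image region and a bounded measurable `φ` of the block variables,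
`∫ dA′ φ(𝒬A′) ρ(A′) = ∫ dy φ(y) ∫ dB (1_S · |det Q_{b₀}|⁻¹ · |det(I − (δ∕δA)D̃)| · ρ∘(id − D̃)) (CB + Hy)` — print's (18)∕(51)∕(2.12) integrand inserted under the
next `dy`-integration ([III] (2.21)). [cite: Balaban1985UV3, (18) p.260, (51) p.268; Balaban1987RG1, (1.4) p.260, (2.12) p.268; Balaban1988Convergent, (2.21) p.258, p.267 L.18–24] -/
theorem integral_comp_chartAvg_mul_eq (hQH : ∀ y, Q (H y) = y) (hH : ∀ y s, H y (e (Sum.inl s)) = 0)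
    (hC : ∀ B s, C B (e (Sum.inl s)) = B s) (hQC : ∀ B, Q (C B) = 0) (hS : MeasurableSet S)
    (h𝒟 : ∀ A ∈ S, HasFDerivWithinAt 𝒟 (L A) S A) (hinj : InjOn (fun A => A - 𝒟 A) S)
    (hlin : ∀ A ∈ S, 𝒬 (A - 𝒟 A) = Q A) (h𝒟m : Measurable 𝒟) (h𝒬m : Measurable 𝒬)
    (hLm : Measurable fun A => |((1 : (ι → X) →L[ℝ] (ι → X)) - L A).det|)
    {ρ : (ι → X) → ℝ} (hρm : Measurable ρ) (hρ : Integrable ρ) (hρS : ∀ A', A' ∉ (fun A => A - 𝒟 A) '' S → ρ A' = 0)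
    {φ : (κ → X) → ℝ} (hφ : Measurable φ) {M : ℝ} (hM : ∀ y, |φ y| ≤ M) :
    ∫ A', φ (𝒬 A') * ρ A' = ∫ y, φ y *
      ∫ B, S.indicator (fun A => |LinearMap.det ((LinearMap.funLeft ℝ X (fun c => e (Sum.inr c))) ∘ₗ H)| *
        |((1 : (ι → X) →L[ℝ] (ι → X)) - L A).det| * ρ (A - 𝒟 A)) (C B + H y) := by
  have h := BalabanUVNodesN11KernelTransportInFibreChart.integral_comp_avg_mul_eq_chart
    (ν := (volume : Measure (ι → X))) (μ := (volume : Measure (κ → X)))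
    (κ := Kernel.const (κ → X) (volume : Measure (σ → X))) (avg := 𝒬)
    (Ψ := fun z : (κ → X) × (σ → X) => (C z.2 + H z.1) - 𝒟 (C z.2 + H z.1))
    (J := fun z : (κ → X) × (σ → X) => S.indicator (fun A =>
      Real.toNNReal |LinearMap.det ((LinearMap.funLeft ℝ X (fun c => e (Sum.inr c))) ∘ₗ H)| *
        Real.toNNReal |((1 : (ι → X) →L[ℝ] (ι → X)) - L A).det|) (C z.2 + H z.1))
    (S := (fun A => A - 𝒟 A) '' S)
    h𝒬m (measurable_chart.sub (h𝒟m.comp measurable_chart))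
    (((measurable_const.mul hLm.real_toNNReal).indicator hS).comp measurable_chart)
    (hpush_linearised hQH hH hC hS h𝒟 hinj h𝒟m hLm) (hfib_linearised hQH hQC hS hlin hLm _) hρm hρ hρS hφ hM
  rw [h]
  refine integral_congr_ae (Filter.Eventually.of_forall fun y => ?_)
  dsimp only
  rw [Kernel.const_apply]
  congr 1
  refine integral_congr_ae (Filter.Eventually.of_forall fun B => ?_)
  dsimp only
  by_cases hB : C B + H y ∈ S
  · rw [indicator_of_mem hB, indicator_of_mem hB, NNReal.coe_mul, Real.coe_toNNReal _ (abs_nonneg _),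
      Real.coe_toNNReal _ (abs_nonneg _)]
  · rw [indicator_of_notMem hB, indicator_of_notMem hB, NNReal.coe_zero, zero_mul]

end Chart

end Summit.QuantumFields.YangMills.Theorems.BalabanUVNodesN11DeltaRemovalLinearisedChart
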